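import Summits.Ventures.PercRepro.RLSRuleLineFreeMain

/-!
# PercRepro — `R₃⁺` on line-free planes of EVERY type: the supply lower bound and the demand upper bound,
both as explicit binomial sums (night-3, gen 3)

For a line-free plane `G` (`LineFree`), an independent set `K ⊆ E ∖ G` and `p = n + 4`, the witnesses `B′ ∪ X`
(`B′ ⊆ G` with `≥ 3` points, `X ⊆ K` with `1 ≤ |X| ≤ n`) are distinct members of the middle level and give `G` the
share `lbShare |B′| |X|` at least (`C(b, 3)/C(b + x, 3)` for `b ≤ 5`, `1` for `b ≥ 6`: the basis-count share when
every trace is in `𝒯₀`, the winner share otherwise — `wPlus_union_ge_lbShare`).  Hence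

* **`supply_ge_of_lineFree`**: `Σ_{B′ ⊆ G} Σ_{i < n} C(|K|, i + 1) · lbShare |B′| (i + 1) ≤ Σ_{S ∈ Yq} w⁺(G, S)` — the
  pure-form supply of the lane (`proofs/N3-R3PLUS-plan.md` §2.1 (ii)), for ANY independent `K` off `G` (no reduced
  world, no Lemma R);
* **`card_UqG_le_of_eRk_compl`**: if `ρ(E ∖ G) + t ≤ p` then every bottom set `B′ ⊆ G` has `3 ≤ |B′|` and
  `|B′| + t ≤ |G|` — the demand is at most `Σ_b C(g, b) · [3 ≤ b ≤ g − t]` (`demandCount`), the lane's `|U^{(t)}|`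
  (for ANY finset `G`, plane or not).
The binomial arithmetic turning these into the landed family theorems `U3.generic_t3` / `U2.generic_t2` /
`U1.generic_t1` is in `RLSRuleLineFreeTypes.lean`.  Imports `RLSRuleLineFreeMain`.  Axioms: standard.
-/

open scoped Matroid

namespace PercRepro

namespace NightThree

open Finset ThmH PerFlat

variable {α : Type*} [DecidableEq α] {M : Matroid α} [M.Finite]

/-- The share lower bound of a rank-`3` subset with `b` points in a witness with `x` outside points:
`C(b, 3)/C(b + x, 3)` for `3 ≤ b ≤ 5`, `1` for `b ≥ 6`, `0` for `b ≤ 2`. -/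
def lbShare (b x : ℕ) : ℚ :=
  if b ≤ 2 then 0 else if b ≤ 5 then (b.choose 3 : ℚ) / ((b + x).choose 3 : ℚ) else 1

/-- `lbShare ≥ 0`. -/
theorem lbShare_nonneg (b x : ℕ) : 0 ≤ lbShare b x := by
  unfold lbShare
  split_ifs <;> positivity

/-- `lbShare` vanishes below `3` points. -/
theorem lbShare_of_le_two {b : ℕ} (h : b ≤ 2) (x : ℕ) : lbShare b x = 0 := by
  unfold lbShare
  rw [if_pos h]

/-- **The share of `G` in `B′ ∪ X` is at least `lbShare |B′| |X|`** (`G` line-free, `B′ ⊆ G` with `≥ 3` points,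
`X` independent and off `G`). -/
theorem wPlus_union_ge_lbShare {G B X : Finset α} (hG : G ∈ flatsQ M 3) (hfree : LineFree M G)
    (hB : B ⊆ G) (hBc : 3 ≤ B.card) (hX : M.Indep (X : Set α)) (hXG : Disjoint X G) :
    lbShare B.card X.card ≤ wPlus M G (B ∪ X) := by
  have hS : B ∪ X ⊆ gr M := by
    apply Finset.union_subset (hB.trans (mem_flatsQ.1 hG).1)
    rw [← Finset.coe_subset, coe_gr]
    exact hX.subset_ground
  have hBtrace : G ∩ (B ∪ X) = B := inter_union_eq_of_disjoint hB hXG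
  have hXB : Disjoint X B := Finset.disjoint_of_subset_right hB hXG
  unfold lbShare
  rw [if_neg (by omega)]
  rcases le_or_gt B.card 5 with h5 | h6
  · rw [if_pos h5]
    have h := wPlus_ge_of_mstar_zero hS (mstar_union_eq_zero_of_lineFree hG hfree hB h5 hX hXG) G
    rw [hBtrace, rho3_eq_choose_of_lineFree (lineFree_subset hfree hB),
      Finset.card_union_of_disjoint hXB.symm] at h
    exact h
  · rw [if_neg (by omega)]
    apply le_of_eq
    symm
    apply wPlus_eq_one_of_unique hS
    · rw [tied_eq_singleton_of_lineFree hG hfree hB (by omega) hX hXG]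
      exact Finset.mem_singleton_self G
    · intro G' hG'
      rw [tied_eq_singleton_of_lineFree hG hfree hB (by omega) hX hXG] at hG'
      exact Finset.mem_singleton.1 hG'

omit [M.Finite] in
/-- A sum over the witness family grouped by size: `Σ_{X ∈ W} f |X| = Σ_{i < n} C(|K|, i + 1) · f (i + 1)`. -/
theorem sum_witnessFamily (K : Finset α) (n : ℕ) (f : ℕ → ℚ) :
    ∑ X ∈ witnessFamily K n, f X.card = ∑ i ∈ range n, (K.card.choose (i + 1) : ℚ) * f (i + 1) := by
  classical
  unfold witnessFamily
  rw [Finset.sum_biUnion (K.pairwise_disjoint_powersetCard.set_pairwise _)]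
  have hinner : ∀ x ∈ Finset.Ico 1 (n + 1),
      ∑ X ∈ K.powersetCard x, f X.card = (K.card.choose x : ℚ) * f x := by
    intro x _
    rw [Finset.sum_congr rfl (fun X hX => by rw [(Finset.mem_powersetCard.1 hX).2]), Finset.sum_const,
      Finset.card_powersetCard, nsmul_eq_mul]
  rw [Finset.sum_congr rfl hinner, Finset.sum_Ico_eq_sum_range, show n + 1 - 1 = n from rfl]
  apply Finset.sum_congr rfl
  intro i _
  rw [add_comm 1 i]

/-- **The supply lower bound on a line-free plane.**  For every independent `K ⊆ E ∖ G` and `p = n + 4`,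
`Σ_{B′ ⊆ G} Σ_{i < n} C(|K|, i + 1) · lbShare |B′| (i + 1) ≤ Σ_{S ∈ Yq} w⁺(G, S)`. -/
theorem supply_ge_of_lineFree {G K : Finset α} (hG : G ∈ flatsQ M 3) (hfree : LineFree M G)
    (hKsub : K ⊆ gr M \ G) (hKind : M.Indep (K : Set α)) (n : ℕ) :
    ∑ B ∈ G.powerset, ∑ i ∈ range n, (K.card.choose (i + 1) : ℚ) * lbShare B.card (i + 1) ≤
      ∑ S ∈ Yq M (n + 4) 3, wPlus M G S := by
  classical
  have hKG : Disjoint K G := by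
    rw [Finset.disjoint_left]
    intro x hxK hxG
    have := hKsub hxK
    rw [Finset.mem_sdiff] at this
    exact this.2 hxG
  -- the witness pairs
  set 𝔅 : Finset (Finset α) := G.powerset.filter (fun B => 3 ≤ B.card) with h𝔅
  have hBmem : ∀ B ∈ 𝔅, B ⊆ G ∧ 3 ≤ B.card := by
    intro B hB
    rw [h𝔅, Finset.mem_filter, Finset.mem_powerset] at hB
    exact hB
  have himg : (𝔅 ×ˢ witnessFamily K n).image (fun q => q.1 ∪ q.2) ⊆ Yq M (n + 4) 3 := by
    intro S hS
    rw [Finset.mem_image] at hS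
    obtain ⟨⟨B, X⟩, hq, rfl⟩ := hS
    rw [Finset.mem_product] at hq
    obtain ⟨hBG, hBc⟩ := hBmem B hq.1
    obtain ⟨hXK, h1, h2⟩ := mem_witnessFamily hq.2
    exact union_mem_Yq_of_subset hG hBG
      (eRk_eq_three_of_lineFree_card hG hBG (lineFree_subset hfree hBG) hBc)
      (hKind.subset (Finset.coe_subset.2 hXK)) (Finset.disjoint_of_subset_left hXK hKG) h1 (by omega)
  have hinj : Set.InjOn (fun q : Finset α × Finset α => q.1 ∪ q.2)
      ((𝔅 ×ˢ witnessFamily K n : Finset (Finset α × Finset α)) : Set (Finset α × Finset α)) := by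
    intro q hq q' hq' h
    obtain ⟨B, X⟩ := q
    obtain ⟨B', X'⟩ := q'
    rw [Finset.mem_coe, Finset.mem_product] at hq hq'
    have hBG := (hBmem B hq.1).1
    have hBG' := (hBmem B' hq'.1).1
    have hXG : Disjoint X G := Finset.disjoint_of_subset_left (mem_witnessFamily hq.2).1 hKG
    have hXG' : Disjoint X' G := Finset.disjoint_of_subset_left (mem_witnessFamily hq'.2).1 hKG
    have h' : B ∪ X = B' ∪ X' := h
    have e1 : G ∩ (B ∪ X) = G ∩ (B' ∪ X') := by rw [h']
    rw [inter_union_eq_of_disjoint hBG hXG, inter_union_eq_of_disjoint hBG' hXG'] at e1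
    have e2 : (B ∪ X) \ B = (B' ∪ X') \ B' := by rw [h', e1]
    rw [Finset.union_sdiff_cancel_left (Finset.disjoint_of_subset_right hBG hXG).symm,
      Finset.union_sdiff_cancel_left (Finset.disjoint_of_subset_right hBG' hXG').symm] at e2
    rw [e1, e2]
  -- the left side restricted to `𝔅` (the other subsets contribute `0`)
  have hsplit : ∑ B ∈ G.powerset, ∑ i ∈ range n, (K.card.choose (i + 1) : ℚ) * lbShare B.card (i + 1) =
      ∑ B ∈ 𝔅, ∑ X ∈ witnessFamily K n, lbShare B.card X.card := by
    rw [h𝔅, Finset.sum_filter]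
    apply Finset.sum_congr rfl
    intro B _
    by_cases hB3 : 3 ≤ B.card
    · rw [if_pos hB3, sum_witnessFamily]
    · rw [if_neg hB3]
      apply Finset.sum_eq_zero
      intro i _
      rw [lbShare_of_le_two (by omega), mul_zero]
  rw [hsplit]
  calc ∑ B ∈ 𝔅, ∑ X ∈ witnessFamily K n, lbShare B.card X.card
      = ∑ q ∈ 𝔅 ×ˢ witnessFamily K n, lbShare q.1.card q.2.card := by
        rw [Finset.sum_product]
    _ ≤ ∑ q ∈ 𝔅 ×ˢ witnessFamily K n, wPlus M G (q.1 ∪ q.2) := by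
        apply Finset.sum_le_sum
        intro q hq
        obtain ⟨B, X⟩ := q
        rw [Finset.mem_product] at hq
        obtain ⟨hBG, hBc⟩ := hBmem B hq.1
        obtain ⟨hXK, _, _⟩ := mem_witnessFamily hq.2
        exact wPlus_union_ge_lbShare hG hfree hBG hBc (hKind.subset (Finset.coe_subset.2 hXK))
          (Finset.disjoint_of_subset_left hXK hKG)
    _ = ∑ S ∈ (𝔅 ×ˢ witnessFamily K n).image (fun q => q.1 ∪ q.2), wPlus M G S :=
        (Finset.sum_image hinj).symm
    _ ≤ ∑ S ∈ Yq M (n + 4) 3, wPlus M G S :=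
        Finset.sum_le_sum_of_subset_of_nonneg himg (fun S _ _ => wPlus_nonneg M G S)

/-! ### The demand -/

/-- The demand count of the lane: `Σ_b C(g, b) · [3 ≤ b ≤ g − t]`. -/
def demandCount (g t : ℕ) : ℚ :=
  ∑ b ∈ range (g + 1), (g.choose b : ℚ) * (if 3 ≤ b ∧ b + t ≤ g then 1 else 0)

omit [M.Finite] in
/-- `ρ(E ∖ B′) ≤ ρ(G ∖ B′) + ρ(E ∖ G)` (for any finsets `B′`, `G`, `E`). -/
theorem eRk_sdiff_le_add (M : Matroid α) (G B E : Finset α) :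
    M.eRk ((E \ B : Finset α) : Set α) ≤ M.eRk ((G \ B : Finset α) : Set α) + M.eRk ((E \ G : Finset α) : Set α) := by
  have hsub : ((E \ B : Finset α) : Set α) ⊆ ((G \ B : Finset α) : Set α) ∪ ((E \ G : Finset α) : Set α) := by
    intro x hx
    rw [Finset.mem_coe, Finset.mem_sdiff] at hx
    by_cases hxG : x ∈ G
    · exact Or.inl (by rw [Finset.mem_coe, Finset.mem_sdiff]; exact ⟨hxG, hx.2⟩)
    · exact Or.inr (by rw [Finset.mem_coe, Finset.mem_sdiff]; exact ⟨hx.1, hxG⟩)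
  exact (M.eRk_mono hsub).trans (M.eRk_union_le_eRk_add_eRk _ _)

/-- **The demand upper bound.**  If `ρ(E ∖ G) + t ≤ p`, every bottom set `B′ ⊆ G` at `(p, 3)` has `3 ≤ |B′|` and
`|B′| + t ≤ |G|`; hence `#U_G ≤ demandCount |G| t`. -/
theorem card_UqG_le_of_eRk_compl (G : Finset α) {p t e : ℕ}
    (he : M.eRk ((gr M \ G : Finset α) : Set α) = e) (het : e + t ≤ p) :
    ((UqG M p 3 G).card : ℚ) ≤ demandCount G.card t := by
  classical
  have hsub : UqG M p 3 G ⊆ G.powerset.filter (fun B => 3 ≤ B.card ∧ B.card + t ≤ G.card) := by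
    intro B hB
    unfold UqG at hB
    rw [Finset.mem_filter, mem_Uq] at hB
    obtain ⟨⟨_, hB3, hBp⟩, hBG⟩ := hB
    rw [Finset.mem_filter, Finset.mem_powerset]
    refine ⟨hBG, three_le_card_of_eRk_eq_three (by exact_mod_cast hB3), ?_⟩
    -- `p = ρ(E ∖ B′) ≤ ρ(G ∖ B′) + e ≤ |G ∖ B′| + e`
    have h1 := eRk_sdiff_le_add M G B (gr M)
    rw [hBp, he] at h1
    have h2 : M.eRk ((G \ B : Finset α) : Set α) ≤ ((G \ B).card : ℕ∞) := by
      have := M.eRk_le_encard ((G \ B : Finset α) : Set α)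
      rwa [Set.encard_coe_eq_coe_finsetCard] at this
    have h3 : (p : ℕ∞) ≤ ((G \ B).card + e : ℕ) := by
      have := h1.trans (add_le_add h2 le_rfl)
      exact_mod_cast this
    have h4 : p ≤ (G \ B).card + e := by exact_mod_cast h3
    have h5 := Finset.card_sdiff_add_card_eq_card hBG
    omega
  have hcard : ((G.powerset.filter (fun B => 3 ≤ B.card ∧ B.card + t ≤ G.card)).card : ℚ) =
      demandCount G.card t := by
    unfold demandCount
    rw [Finset.card_filter, Nat.cast_sum]
    rw [Finset.sum_powerset_apply_card (fun b => ((if 3 ≤ b ∧ b + t ≤ G.card then 1 else 0 : ℕ) : ℚ))]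
    apply Finset.sum_congr rfl
    intro b _
    rw [nsmul_eq_mul]
    congr 1
    split_ifs <;> simp
  rw [← hcard]
  exact_mod_cast Finset.card_le_card hsub

end NightThree

end PercRepro
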